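import Mathlib
import Literature.NumberTheory.GaloisRepresentations.SGeneralQuadraticFamily
import Literature.NumberTheory.GaloisRepresentations.ArtinRestriction
import Literature.NumberTheory.Automorphic.QuadraticCharacterTwist
import Literature.NumberTheory.Automorphic.TunnellOctahedralGlobal

/-!
# Icosahedral quadratic descent — preliminaries, IV: the compositum `L = K''·K` and the
# splitting law `ε_{L/K''}(w) = ε_{K/ℚ}(v)^{f(w|v)}`

* `mem_range_iff_restrict_mem_range_of_sq_eq` — the Galois identity: if `M = F(s_M)` and
  `N = E(s_N)` with `s_M² = c = s_N²` (`c ∈ F`, `E ⊇ F`), then `Γ_N ≤ Γ_E` is the preimage of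
  `Γ_M ≤ Γ_F` under restriction `Γ_E → Γ_F`.
* The field `L = K''(√-D₀)` over `K'' = ℚ(√-D)` with its `K = ℚ(√-D₀)`-algebra structure.
* `eventually_quadraticSign_eq_pow` — the splitting law for `L/K''` against `K/ℚ`.
-/

set_option linter.dupNamespace false

noncomputable section

open scoped NumberField
open NumberField IsDedekindDomain Field Filter
open Literature.NumberTheory.GaloisRepresentations Literature.NumberTheory.GaloisRepresentations.QuadraticFamily
open Literature.NumberTheory.Automorphic

namespace Summit.Langlands.Langlands.Theorems.IcosahedralQuadraticDescent

/-! ## The Galois identity for a compositum with a quadratic field -/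

section GaloisIdentity

variable {F E M N : Type*} [Field F] [Field E] [Field M] [Field N]
  [Algebra F E] [Algebra F M] [Algebra E N] [Algebra.IsAlgebraic F M] [Algebra.IsAlgebraic E N]

omit [Algebra F E] [Algebra F M] [Algebra E N] [Algebra.IsAlgebraic F M]
  [Algebra.IsAlgebraic E N] in
/-- In a domain, `t'² = t²` forces `t' = t` or `t' = -t`. [folklore] -/
theorem eq_or_eq_neg_of_sq_eq_sq' {R : Type*} [CommRing R] [IsDomain R] {t t' : R}
    (h : t' ^ 2 = t ^ 2) : t' = t ∨ t' = -t := by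
  have h0 : (t' - t) * (t' + t) = 0 := by linear_combination h
  rcases mul_eq_zero.mp h0 with h1 | h1
  · exact Or.inl (by linear_combination h1)
  · exact Or.inr (by linear_combination h1)

/-- **The Galois identity for a compositum.**  Let `E ⊇ F` be fields, `M = F(s_M)` with
`s_M² = c ∈ F` and `N = E(s_N)` with `s_N² = c` (every element of `M`, resp. `N`, is
`a + b·s`).  Then for `γ ∈ Γ_E`: `γ ∈ Γ_N` (the image of `Γ_N → Γ_E`) iff the restriction of `γ`
to `Γ_F` lies in `Γ_M` (the image of `Γ_M → Γ_F`).  Both say that `γ` fixes a square root of `c`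
in `Ē`. [folklore] -/
theorem mem_range_iff_restrict_mem_range_of_sq_eq (c : F) (sM : M) (sN : N)
    (hsM : sM ^ 2 = algebraMap F M c)
    (hM : ∀ y : M, ∃ a b : F, y = algebraMap F M a + algebraMap F M b * sM)
    (hsN : sN ^ 2 = algebraMap E N (algebraMap F E c))
    (hN : ∀ x : N, ∃ a b : E, x = algebraMap E N a + algebraMap E N b * sN)
    (γ : absoluteGaloisGroup E) :
    γ ∈ (absGaloisRestrict E N).range ↔ absGaloisRestrict F E γ ∈ (absGaloisRestrict F M).range := by
  obtain ⟨eN, heN⟩ := exists_mem_range_absGaloisRestrict_iff E N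
  obtain ⟨eM, heM⟩ := exists_mem_range_absGaloisRestrict_iff F M
  set abs := absClosureEmbedding F E with habs
  set t : AlgebraicClosure E := eN sN with ht
  set t' : AlgebraicClosure E := abs (eM sM) with ht'
  -- both `t` and `t'` are square roots of `c`
  have htsq : t ^ 2 = algebraMap F (AlgebraicClosure E) c := by
    rw [ht, ← map_pow, hsN, AlgHom.commutes, ← IsScalarTower.algebraMap_apply]
  have ht'sq : t' ^ 2 = algebraMap F (AlgebraicClosure E) c := by
    rw [ht', ← map_pow, ← map_pow, hsM, AlgHom.commutes, AlgHom.commutes]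
  have htt' : t' = t ∨ t' = -t := eq_or_eq_neg_of_sq_eq_sq' (ht'sq.trans htsq.symm)
  -- `γ` fixes `E`, hence `F`
  have hfixE : ∀ a : E, γ • algebraMap E (AlgebraicClosure E) a = algebraMap E _ a := fun a => by
    rw [absoluteGaloisGroup.smul_def, AlgEquiv.commutes]
  have hfixF : ∀ a : F, γ • algebraMap F (AlgebraicClosure E) a = algebraMap F _ a := fun a => by
    rw [IsScalarTower.algebraMap_apply F E (AlgebraicClosure E), hfixE]
  -- left side: `γ` fixes `e_N(N)` iff it fixes `t`
  have hL : γ ∈ (absGaloisRestrict E N).range ↔ γ • t = t := by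
    rw [heN]
    constructor
    · intro h; exact h sN
    · intro h x
      obtain ⟨a, b, rfl⟩ := hN x
      rw [map_add, map_mul, AlgHom.commutes, AlgHom.commutes, smul_add, smul_mul', hfixE, hfixE,
        ← ht, h]
  -- right side: `res γ` fixes `e_M(M)` iff `γ` fixes `t'`
  have hR : absGaloisRestrict F E γ ∈ (absGaloisRestrict F M).range ↔ γ • t' = t' := by
    rw [heM]
    have key : ∀ y : M, (absGaloisRestrict F E γ • eM y = eM y ↔ γ • abs (eM y) = abs (eM y)) := by
      intro y
      rw [← absGaloisRestrict_apply_smul]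
      exact ⟨fun h => by rw [h], fun h => abs.injective h⟩
    constructor
    · intro h; exact (key sM).mp (h sM)
    · intro h y
      rw [key]
      obtain ⟨a, b, rfl⟩ := hM y
      rw [map_add, map_mul, AlgHom.commutes, AlgHom.commutes, map_add, map_mul, AlgHom.commutes,
        AlgHom.commutes, smul_add, smul_mul', hfixF, hfixF, ← ht', h]
  rw [hL, hR]
  rcases htt' with h | h
  · rw [h]
  · rw [h, smul_neg, neg_inj]

end GaloisIdentity

/-! ## The compositum `L = K''(√-D₀)` -/

section Compositum

variable (D₀ D : ℕ) [Fact (¬ IsSquare (-(D₀ : ℚ)))] [Fact (¬ IsSquare (-(D : ℚ)))]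

/-- `-D₀` is not a square in `ℚ(√-D)` when `D₀ D` is not a square in `ℚ`
(`isSquare_mul_of_sq_eq`). [folklore] -/
theorem not_isSquare_neg_natCast_sqrtNegField (h : ¬ IsSquare ((D * D₀ : ℕ) : ℚ)) :
    ¬ IsSquare (-(D₀ : sqrtNegField ℚ D)) := by
  rintro ⟨x, hx⟩
  apply h
  refine isSquare_mul_of_sq_eq (K := ℚ) (D := D) (D' := D₀) (x := x) ?_
  rw [sq, ← hx, map_neg, map_natCast]

/-- **The compositum** `L = K''(√-D₀)`, `K'' = ℚ(√-D)`, as a member of the quadratic family over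
`K''`. [folklore] -/
abbrev compositum : Type := sqrtNegField (sqrtNegField ℚ D) D₀

variable [Fact (¬ IsSquare (-(D₀ : sqrtNegField ℚ D)))]

omit [Fact (¬ IsSquare (-(D₀ : ℚ)))] in
/-- `ω_L² = -D₀` in the compositum, in the normal form of `QuadraticAlgebra.lift`. [folklore] -/
theorem omega_compositum_mul_self :
    (QuadraticAlgebra.omega : compositum D₀ D) * QuadraticAlgebra.omega =
      (-(D₀ : ℚ)) • (1 : compositum D₀ D) + (0 : ℚ) • QuadraticAlgebra.omega := by
  rw [zero_smul, add_zero, ← sq, omega_sq, Algebra.smul_def, mul_one, map_neg, map_natCast, map_neg,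
    map_natCast]

/-- The `ℚ`-algebra map `K = ℚ(√-D₀) → L = K''(√-D₀)`, `ω ↦ ω`. [folklore] -/
def toCompositum : sqrtNegField ℚ D₀ →ₐ[ℚ] compositum D₀ D :=
  QuadraticAlgebra.lift ⟨QuadraticAlgebra.omega, omega_compositum_mul_self D₀ D⟩

/-- `K = ℚ(√-D₀)`-algebra structure on the compositum. [folklore] -/
instance algebraCompositum : Algebra (sqrtNegField ℚ D₀) (compositum D₀ D) :=
  (toCompositum D₀ D).toRingHom.toAlgebra

/-- Unfolding the algebra map `K → L`. [folklore] -/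
theorem algebraMap_compositum_eq : algebraMap (sqrtNegField ℚ D₀) (compositum D₀ D) =
    (toCompositum D₀ D).toRingHom := rfl

/-- The tower `ℚ ⊂ K ⊂ L`. [folklore] -/
instance isScalarTower_compositum : IsScalarTower ℚ (sqrtNegField ℚ D₀) (compositum D₀ D) :=
  IsScalarTower.of_algebraMap_eq fun x => by
    rw [algebraMap_compositum_eq]
    exact ((toCompositum D₀ D).commutes x).symm

/-- The image of `ω_K` in `L` is `ω_L`. [folklore] -/
theorem algebraMap_omega :
    algebraMap (sqrtNegField ℚ D₀) (compositum D₀ D) QuadraticAlgebra.omega = QuadraticAlgebra.omega := by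
  rw [algebraMap_compositum_eq]
  change (QuadraticAlgebra.omega : sqrtNegField ℚ D₀).re • (1 : compositum D₀ D) +
    (QuadraticAlgebra.omega : sqrtNegField ℚ D₀).im • (QuadraticAlgebra.omega : compositum D₀ D) = _
  rw [QuadraticAlgebra.omega_re, QuadraticAlgebra.omega_im, zero_smul, one_smul, zero_add]

end Compositum

/-! ## The splitting law -/

section SplittingLaw

/-- Every element of a quadratic algebra is `a + b ω`. [folklore] -/
theorem exists_eq_add_mul_omega {R : Type*} [Field R] {a b : R} (y : QuadraticAlgebra R a b) :
    ∃ u v : R, y = algebraMap R _ u + algebraMap R _ v * QuadraticAlgebra.omega := by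
  obtain ⟨r, i⟩ := y
  refine ⟨r, i, ?_⟩
  rw [QuadraticAlgebra.mk_eq_add_smul_omega r i]
  simp [Algebra.smul_def]

variable (D₀ D : ℕ) [Fact (¬ IsSquare (-(D₀ : ℚ)))] [Fact (¬ IsSquare (-(D : ℚ)))]
  [Fact (¬ IsSquare (-(D₀ : sqrtNegField ℚ D)))]

/-- The Galois identity for `L = K''(√-D₀) ⊇ K'' = ℚ(√-D)` against `K = ℚ(√-D₀)`:
`Γ_L = res⁻¹(Γ_K)` inside `Γ_{K''}`. [folklore] -/
theorem mem_range_compositum_iff (γ : absoluteGaloisGroup (sqrtNegField ℚ D)) :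
    γ ∈ (absGaloisRestrict (sqrtNegField ℚ D) (compositum D₀ D)).range ↔
      absGaloisRestrict ℚ (sqrtNegField ℚ D) γ ∈ (absGaloisRestrict ℚ (sqrtNegField ℚ D₀)).range :=
  mem_range_iff_restrict_mem_range_of_sq_eq (F := ℚ) (E := sqrtNegField ℚ D)
    (M := sqrtNegField ℚ D₀) (N := compositum D₀ D) (-(D₀ : ℚ)) QuadraticAlgebra.omega
    QuadraticAlgebra.omega omega_sq exists_eq_add_mul_omega
    (by rw [omega_sq, map_neg (algebraMap ℚ (sqrtNegField ℚ D)), map_natCast])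
    exists_eq_add_mul_omega γ

/-- A `1 × 1` invertible matrix is `1` iff its entry is `1`. [folklore] -/
theorem gl_one_eq_one_iff (g : GL (Fin 1) ℂ) : g = 1 ↔ (g : Matrix (Fin 1) (Fin 1) ℂ) 0 0 = 1 := by
  constructor
  · intro h; rw [h]; simp
  · intro h
    ext i j
    rw [Subsingleton.elim i 0, Subsingleton.elim j 0, h]
    simp

/-- **The splitting law** for the compositum: at almost every finite place `w` of `K'' = ℚ(√-D)`,
with `v` the place of `ℚ` below, `ε_{L/K''}(w) = ε_{K/ℚ}(v)^{f(w|v)}` — a place of `K''` splits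
in `L = K''K` iff the place below splits in `K` or has residue degree `2` in `K''`.  Proof: the
quadratic character of `L/K''` is the restriction of that of `K/ℚ` (`mem_range_compositum_iff`),
and the Frobenius of `w` restricts to `Frob_v^{f(w|v)}`
(`FramedGaloisRep.exists_restrictField_apply_eq_pow`); read both through the Frobenius dictionary
`quadraticArtinChar_apply_frob_coe`. [folklore] -/
theorem eventually_quadraticSign_eq_pow
    (h2K : Module.finrank ℚ (sqrtNegField ℚ D₀) = 2)
    (h2L : Module.finrank (sqrtNegField ℚ D) (compositum D₀ D) = 2) :
    ∀ᶠ w : HeightOneSpectrum (𝓞 (sqrtNegField ℚ D)) in cofinite,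
      ∀ v : HeightOneSpectrum (𝓞 ℚ), w.asIdeal.under (𝓞 ℚ) = v.asIdeal →
        quadraticSign (compositum D₀ D) w =
          quadraticSign (sqrtNegField ℚ D₀) v ^ w.asIdeal.inertiaDeg (𝓞 ℚ) := by
  set K := sqrtNegField ℚ D₀
  set E := sqrtNegField ℚ D
  set L := compositum D₀ D
  set χL := quadraticArtinChar E L h2L with hχL
  set χK := quadraticArtinChar ℚ K h2K with hχK
  have h2E : Module.finrank ℚ E = 2 := finrank_sqrtNegField
  -- the good places
  have hA : ∀ᶠ w : HeightOneSpectrum (𝓞 E) in cofinite, Algebra.IsUnramifiedIn (𝓞 L) w.asIdeal := by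
    rw [Filter.eventually_cofinite]; exact finite_setOf_not_isUnramifiedIn E L
  have hB := eventually_isUnramifiedAt_quadraticArtinChar (F := E) (E := L) h2L
  have hC0 : ∀ᶠ v : HeightOneSpectrum (𝓞 ℚ) in cofinite, Algebra.IsUnramifiedIn (𝓞 K) v.asIdeal := by
    rw [Filter.eventually_cofinite]; exact finite_setOf_not_isUnramifiedIn ℚ K
  have hC := eventually_under (E := E) (hC0.and (eventually_isUnramifiedAt_quadraticArtinChar h2K))
  filter_upwards [hA, hB, hC] with w hwL hwχ hwv v hv
  obtain ⟨hvK, hvχ⟩ := hwv v hv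
  -- a Frobenius at `w`
  obtain ⟨𝔔, h𝔔⟩ := HeightOneSpectrum.primesAbove_nonempty w
  obtain ⟨τ, hτ⟩ := HeightOneSpectrum.exists_isArithFrobAt_of_mem_primesAbove_holds h𝔔
  have e1 : ((χL τ : GL (Fin 1) ℂ) : Matrix (Fin 1) (Fin 1) ℂ) 0 0 = quadraticSign L w :=
    quadraticArtinChar_apply_frob_coe h2L hwL hwχ h𝔔 hτ 0 0
  -- restriction of the Frobenius
  obtain ⟨𝔓, h𝔓, φ, hφ, hres⟩ :=
    FramedGaloisRep.exists_restrictField_apply_eq_pow χK hv hvχ h𝔔 hτ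
  have e2 : ((χK φ : GL (Fin 1) ℂ) : Matrix (Fin 1) (Fin 1) ℂ) 0 0 = quadraticSign K v :=
    quadraticArtinChar_apply_frob_coe h2K hvK hvχ h𝔓 hφ 0 0
  -- the Galois identity on `τ`
  have key : χL τ = 1 ↔ χK φ ^ w.asIdeal.inertiaDeg (𝓞 ℚ) = 1 := by
    rw [hχL, quadraticArtinChar_apply_eq_one_iff, mem_range_compositum_iff, ← hres,
      FramedGaloisRep.restrictField_apply, hχK, quadraticArtinChar_apply_eq_one_iff]
  -- case on the residue degree
  have hsK := quadraticSign_eq_one_or (E := K) (v := v)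
  have hsL := quadraticSign_eq_one_or (E := L) (v := w)
  rcases inertiaDeg_eq_one_or_two_of_finrank_eq_two h2E v w hv with hf | hf
  · rw [hf, pow_one] at key ⊢
    rw [gl_one_eq_one_iff, gl_one_eq_one_iff, e1, e2] at key
    rcases hsK with h | h <;> rcases hsL with h' | h'
    · rw [h, h']
    · exact absurd (key.mpr h) (by rw [h']; norm_num)
    · exact absurd (key.mp h') (by rw [h]; norm_num)
    · rw [h, h']
  · rw [hf] at key ⊢
    have h1 : χK φ ^ 2 = 1 := quadraticArtinChar_apply_sq h2K φ
    have h3 : quadraticSign L w = 1 := by rw [← e1, ← gl_one_eq_one_iff]; exact key.mpr h1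
    rw [h3, sq, quadraticSign_mul_self]

end SplittingLaw

end Summit.Langlands.Langlands.Theorems.IcosahedralQuadraticDescent

end
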